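import Literature.Geometry.Lorentzian.ImmersionChartMetric
import Literature.Geometry.Lorentzian.IsometricImmersionExp
import Literature.Geometry.Lorentzian.GeodesicLiftContinuation
import Literature.Geometry.Lorentzian.OpensChartGeodesicODE
import Literature.Geometry.Lorentzian.ChartMetricCoord
import Literature.Geometry.Lorentzian.CommonDevelopmentRigidity
import Literature.Geometry.Lorentzian.NormalisedNullRayCausal
import Literature.Geometry.Lorentzian.LeviCivitaProofs
import HarnessLib

/-!
# Crux `SettledCapture` (stmt-FinalStateConjecture-17328), line `null-concave-crush`:
# GEODESICS IN AN IMMERSED OPEN CHART pull back to coordinate geodesics (brick of stub 3a)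

Route `BartnikGapSettling`; helper (`--supports stmt-FinalStateConjecture-17328`, registered sub-goal
`stub_crushChartGeodesicLift`) for the registered stub `stub_chartNullGeodesic` of the checked skeleton
`Cruxes/SettledCapture/Lines/null_concave_crush.lean` (rev 5). Generic Lorentzian plumbing, no Kerr in sight:

**Setting.** `𝓢` a spacetime with its Levi-Civita connection, `U : Opens E4`, `Ψ : U → 𝓢`, an OPEN set `S ⊆ U` on
which `Ψ` is smooth, an open topological embedding, and an immersion; `G` a field of components on `E4` which on
`S` are those of `Ψ^* g` (`G x v w = g(dΨ_x v, dΨ_x w)`); `γ` a maximal geodesic of `𝓢` on `dom` whose parameter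
tail `{t ∈ dom, t ≥ t₀}` lies in `Ψ '' S`.

**Conclusion** (`stub_crushChartGeodesicLift`). There are `β β₁ : ℝ → E4` such that at every tail parameter `t`:
`β t = x.1` for the (unique) `x ∈ S` with `Ψ x = γ t`, `dΨ_x (β₁ t) = γ'(t)`, `β` is `C²` at `t`, `β' = β₁` and
`β₁' = −Γ_G(β₁, β₁)` (`MetricCoord.chrAt`) — the coordinate geodesic equation.

**Proof.** On the open `W = val '' S ⊆ E4` the map `ΨW = Ψ ∘ incl` is a smooth immersion, so `gW := ΨW^* g`
(`ImmersionChart.metric`) is a smooth metric on `W` with its Levi-Civita connection (`PseudoRiemannianMetric.hasLeviCivita`)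
and `ΨW : (W, gW) → (𝓢, g)` is an injective isometric immersion; maximal geodesics of `W` map to geodesics of `𝓢`
(`IsIsometricImmersion.isGeodesicOn_comp`), which with uniqueness of maximal geodesics in `𝓢`
(`exists_isMaximalGeodesicOn`) gives LOCAL LIFTS of `γ` through every point of `ΨW(W)`; the continuation principle
`IsMaximalGeodesicOn.mem_of_forall_exists_lift` extends the lift at `t₀` over the whole tail; the coordinate geodesic
equation and smoothness are `OpensChart.hasDerivAt_of_isGeodesicOn` / `contDiffAt_of_isGeodesicOn` with
`OpensChart.christoffel_eq_chrAt`.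

References: O'Neill 1983, Ch. 3, Cor. 21, Lemma 22, Prop. 24, pp. 90–91 (Prop. 3.59).
-/

noncomputable section

-- instance search through the nested operator types `E4 →L[ℝ] E4 →L[ℝ] E4 →L[ℝ] ℝ`
set_option maxSynthPendingDepth 3

-- D-0017: single-problem summit, `Summit.<S>.<S>.…` by design (cf. lakefile `weak.linter.dupNamespace`).
set_option linter.dupNamespace false

namespace Summit.FinalStateConjecture.FinalStateConjecture.Theorems.BartnikGapSettling.SettledCapture

open Set Filter Function TopologicalSpace
open scoped Manifold ContDiff Topology
open Literature.Geometry.Lorentzian Literature.Geometry.Lorentzian.MetricCoord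

/-- `(∞ : ℕ∞ω) + 1 = ∞`. [folklore] -/
private theorem lift_infty_add_one : (∞ : ℕ∞ω) + 1 = ∞ := by
  show ((⊤ : ℕ∞) : ℕ∞ω) + 1 = ((⊤ : ℕ∞) : ℕ∞ω)
  rw [← WithTop.coe_one, ← WithTop.coe_add, WithTop.coe_eq_coe]
  exact top_add _

/-- **A maximal geodesic is THE geodesic with its initial data**: every geodesic on an open interval about a
parameter `b` of a maximal geodesic `γ`, with the same position and velocity at `b` (read at its own parameter `0`),
is defined only where `γ(· + b)` is and agrees with it (uniqueness of maximal geodesics,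
`exists_isMaximalGeodesicOn`, translated by `IsMaximalGeodesicOn.comp_add`). [cite: ONeill1983, Ch. 3, Prop. 24] -/
private theorem lift_sub_of_isMaximal (𝓢 : Spacetime.{0} 4) [𝓢.metric.HasLeviCivita]
    {γ : ℝ → 𝓢.carrier} {dom : Set ℝ} (hγ : IsMaximalGeodesicOn 𝓢.metric.leviCivita γ dom) {b : ℝ}
    (hb : b ∈ dom) {ρ : ℝ → 𝓢.carrier} {D : Set ℝ} (hD : IsOpen D) (hDc : D.OrdConnected) (h0 : (0 : ℝ) ∈ D)
    (hρ : IsGeodesicOn 𝓢.metric.leviCivita ρ D) (hρ0 : ρ 0 = γ b)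
    (hρv : velocity (𝓡 4) ρ 0 = velocity (𝓡 4) γ b) :
    ∀ u ∈ D, u + b ∈ dom ∧ ρ u = γ (u + b) := by
  haveI := LorentzianMetric.contMDiffCovariantDerivative_leviCivita_one 𝓢.metric
  -- the translate `c u = γ (u + b)` is a maximal geodesic on `{u | u + b ∈ dom}`
  have hc : IsMaximalGeodesicOn 𝓢.metric.leviCivita (fun u ↦ γ (u - (-b))) {u | u + b ∈ dom} := hγ.comp_add b
  have hc0 : (0 : ℝ) ∈ {u : ℝ | u + b ∈ dom} := by simpa using hb
  have h0b : (0 : ℝ) - -b = b := by ring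
  have hcb : (fun u ↦ γ (u - (-b))) 0 = γ b := by
    show γ (0 - -b) = γ b
    rw [h0b]
  have hcv : velocity (𝓡 4) (fun u ↦ γ (u - (-b))) 0 = velocity (𝓡 4) γ b := by
    rw [velocity_comp_sub_const, h0b]
  -- THE maximal geodesic with data `(γ b, γ' b)`
  obtain ⟨μ, s, hμ, hs0, hμ0, hμv, huniv⟩ :=
    exists_isMaximalGeodesicOn (cov := 𝓢.metric.leviCivita) (γ b) (velocity (𝓡 4) γ b)
  -- the translate is contained in it, and by its own maximality equals it
  obtain ⟨hcs, hceq⟩ := huniv _ _ hc.isOpen hc.2.1 hc0 hc.isGeodesicOn hcb hcv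
  have hs_eq : s = {u : ℝ | u + b ∈ dom} :=
    hc.2.2.2 μ s hμ.isOpen hμ.2.1 hcs hμ.isGeodesicOn hceq
  -- `ρ` is contained in it too
  obtain ⟨hρs, hρeq⟩ := huniv ρ D hD hDc h0 hρ hρ0 hρv
  intro u hu
  have hus : u ∈ s := hρs hu
  have hudom : u + b ∈ dom := by rw [hs_eq] at hus; exact hus
  refine ⟨hudom, ?_⟩
  have h1 : ρ u = μ u := hρeq hu
  have h2 : (fun u ↦ γ (u - (-b))) u = μ u := hceq (by rw [← hs_eq]; exact hus)
  simp only [sub_neg_eq_add] at h2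
  rw [h1, ← h2]

/-- **Geodesics in an immersed open chart pull back to coordinate geodesics** (registered sub-goal
`stub_crushChartGeodesicLift` of crux `SettledCapture`, line `null-concave-crush`; brick of stub 3a
`stub_chartNullGeodesic`). See the module docstring for setting, conclusion and proof.
[cite: ONeill1983, Ch. 3, Cor. 21, Prop. 24, pp. 90–91] -/
theorem stub_crushChartGeodesicLift : ∀ (𝓢 : Spacetime.{0} 4) [𝓢.metric.HasLeviCivita] (U : TopologicalSpace.Opens E4) (Ψ : U → 𝓢.carrier) (S : Set U), IsOpen S → ContMDiffOn 𝓘(ℝ, E4) (𝓡 4) ((⊤ : ℕ∞) : WithTop ℕ∞) Ψ S → Topology.IsOpenEmbedding (S.restrict Ψ) → (∀ x ∈ S, Function.Injective (mfderiv 𝓘(ℝ, E4) (𝓡 4) Ψ x)) → ∀ (G : E4 → E4 →L[ℝ] E4 →L[ℝ] ℝ), (∀ x ∈ S, ∀ v w : E4, G x.1 v w = 𝓢.metric.val (Ψ x) (mfderiv 𝓘(ℝ, E4) (𝓡 4) Ψ x v) (mfderiv 𝓘(ℝ, E4) (𝓡 4) Ψ x w)) → ∀ (γ : ℝ → 𝓢.carrier)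 (dom : Set ℝ), IsMaximalGeodesicOn 𝓢.metric.leviCivita γ dom → ∀ t₀ ∈ dom, (∀ t ∈ dom, t₀ ≤ t → γ t ∈ Ψ '' S) → ∃ β β₁ : ℝ → E4, ∀ t ∈ dom, t₀ ≤ t → (∃ x ∈ S, Ψ x = γ t ∧ β t = x.1 ∧ mfderiv 𝓘(ℝ, E4) (𝓡 4) Ψ x (β₁ t) = velocity (𝓡 4) γ t) ∧ ContDiffAt ℝ 2 β t ∧ HasDerivAt β (β₁ t) t ∧ HasDerivAt β₁ (-(MetricCoord.chrAt G (β t) (β₁ t) (β₁ t))) t := by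
  intro 𝓢 _ U Ψ S hS hΨ hemb hinj' G hG γ dom hγ t₀ ht₀ htail
  haveI := LorentzianMetric.contMDiffCovariantDerivative_leviCivita_one 𝓢.metric
  haveI : Fact ((1 : ℕ∞ω) ≤ ∞) := ⟨WithTop.coe_le_coe.2 le_top⟩
  have hdom : dom.OrdConnected := hγ.2.1
  /- 1. the open submanifold `W = val '' S` and the chart `ΨW = Ψ ∘ incl` -/
  set W : Opens E4 := ⟨Subtype.val '' S, U.isOpen.isOpenMap_subtype_val S hS⟩ with hWdef
  have hWU : W ≤ U := by
    rintro z ⟨x, -, rfl⟩; exact x.2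
  set ι : W → U := Opens.inclusion hWU with hιdef
  have hιS : ∀ y : W, ι y ∈ S := by
    intro y
    obtain ⟨x, hx, hxy⟩ := (show (y : E4) ∈ Subtype.val '' S from y.2)
    have : ι y = x := Subtype.ext (by rw [← hxy])
    rw [this]; exact hx
  have hιval : ∀ y : W, ((ι y : U) : E4) = (y : E4) := fun y ↦ rfl
  set ΨW : W → 𝓢.carrier := Ψ ∘ ι with hΨWdef
  have hΨsm : ∀ x ∈ S, ContMDiffAt 𝓘(ℝ, E4) (𝓡 4) ∞ Ψ x := fun x hx ↦ hΨ.contMDiffAt (hS.mem_nhds hx)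
  have hΨW : ContMDiff 𝓘(ℝ, E4) (𝓡 4) ∞ ΨW :=
    hΨ.comp_contMDiff (contMDiff_inclusion hWU) fun y ↦ hιS y
  have hdΨW : ∀ y : W, mfderiv 𝓘(ℝ, E4) (𝓡 4) ΨW y = mfderiv 𝓘(ℝ, E4) (𝓡 4) Ψ (ι y) := fun y ↦
    mfderiv_comp_inclusion hWU ((hΨsm _ (hιS y)).mdifferentiableAt (by simp))
  have hΨW' : ∀ y : W, Function.Injective (mfderiv 𝓘(ℝ, E4) (𝓡 4) ΨW y) := fun y ↦ by
    rw [hdΨW]; exact hinj' _ (hιS y)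
  have hΨW1 : ContMDiff 𝓘(ℝ, E4) (𝓡 4) (∞ + 1) ΨW := by rw [lift_infty_add_one]; exact hΨW
  have hΨWinj : Function.Injective ΨW := by
    intro y₁ y₂ h
    have h' : S.restrict Ψ ⟨ι y₁, hιS y₁⟩ = S.restrict Ψ ⟨ι y₂, hιS y₂⟩ := h
    have h'' := congrArg (fun x : S ↦ ((x : U) : E4)) (hemb.injective h')
    exact Subtype.ext h''
  have hrange : Ψ '' S = range ΨW := by
    ext p
    constructor
    · rintro ⟨x, hx, rfl⟩
      refine ⟨⟨x.1, mem_image_of_mem _ hx⟩, ?_⟩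
      show Ψ (ι ⟨x.1, _⟩) = Ψ x
      congr 1
    · rintro ⟨y, rfl⟩
      exact ⟨ι y, hιS y, rfl⟩
  /- 2. the pulled-back metric `gW = ΨW^* g` on `W`, its Levi-Civita connection, the isometric immersion -/
  set gW := ImmersionChart.metric 𝓢.metric.toPseudoRiemannianMetric hΨW1 hΨW' rfl with hgWdef
  haveI hLC : gW.HasLeviCivita := gW.hasLeviCivita
  haveI : CovariantDerivative.ContMDiffCovariantDerivative gW.leviCivita 1 :=
    ⟨gW.isLocallyContMDiff_leviCivita_holds 1
      (by rw [show ((1 : ℕ∞) : ℕ∞ω) + 1 = 2 by norm_num]; exact WithTop.coe_le_coe.2 le_top)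
      univ isOpen_univ⟩
  have hiso : PseudoRiemannianMetric.IsIsometricImmersion gW 𝓢.metric.toPseudoRiemannianMetric ΨW :=
    ⟨hΨW, fun y ↦ rfl⟩
  have hdim : Module.finrank ℝ E4 = Module.finrank ℝ E4 := rfl
  -- the components of `gW` are `G` on `W`
  have hGW : ∀ y : W, gW.val y = G y := by
    intro y
    ext v w
    rw [ImmersionChart.metric_val, hdΨW y]
    exact (hG (ι y) (hιS y) v w).symm
  have hGmet : IsMetricOn G (W : Set E4) := OpensChart.isMetricOn_repr hGW
  have hGd : ∀ y : W, DifferentiableAt ℝ G y := fun y ↦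
    ((hGmet.contDiffOn y.1 y.2).contDiffAt (W.isOpen.mem_nhds y.2)).differentiableAt (by simp)
  -- the Christoffel data is smooth
  have hΓsm : ContDiffOn ℝ ∞ (fun q : E4 × E4 ↦ chrAt G q.1 q.2 q.2) ((W : Set E4) ×ˢ univ) := by
    have h1 : ContDiffOn ℝ ∞ (fun q : E4 × E4 ↦ chrAt G q.1) ((W : Set E4) ×ˢ univ) :=
      hGmet.contDiffOn_chrAt.comp contDiffOn_fst fun q hq ↦ hq.1
    exact (h1.clm_apply contDiffOn_snd).clm_apply contDiffOn_snd
  have hΓeq : ∀ (y : W) (v : E4), chrAt G y v v = OpensChart.christoffel gW G y v v := fun y v ↦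
    (OpensChart.christoffel_eq_chrAt hGW y v v).symm
  /- 3. local lifts: through every point of `ΨW(W)` that `γ` visits -/
  have key : ∀ b ∈ dom, ∀ y : W, ΨW y = γ b → ∃ (ζ : ℝ → W) (D : Set ℝ),
      IsMaximalGeodesicOn gW.leviCivita ζ D ∧ (0 : ℝ) ∈ D ∧
        (∀ u ∈ D, u + b ∈ dom ∧ ΨW (ζ u) = γ (u + b)) ∧
        ∀ u ∈ D, mfderiv 𝓘(ℝ, E4) (𝓡 4) ΨW (ζ u) (velocity 𝓘(ℝ, E4) ζ u) = velocity (𝓡 4) γ (u + b) := by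
    intro b hb y hy
    -- the initial velocity in the chart (dΨW is bijective)
    have hsurj : Function.Surjective (mfderiv 𝓘(ℝ, E4) (𝓡 4) ΨW y) := by
      have h := (mfderiv 𝓘(ℝ, E4) (𝓡 4) ΨW y).toLinearMap.injective_iff_surjective_of_finrank_eq_finrank
        (show Module.finrank ℝ E4 = Module.finrank ℝ E4 from rfl)
      exact h.1 (hΨW' y)
    obtain ⟨v, hv⟩ := hsurj (velocity (𝓡 4) γ b)
    obtain ⟨ζ, D, hζ, hD0, hζ0, hζv, -⟩ := exists_isMaximalGeodesicOn (cov := gW.leviCivita) y v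
    obtain ⟨hgeo, hvel⟩ := hiso.isGeodesicOn_comp hdim hζ.isOpen hζ.isGeodesicOn
    have hρ0 : (ΨW ∘ ζ) 0 = γ b := by simp [hζ0, hy]
    have hρv : velocity (𝓡 4) (ΨW ∘ ζ) 0 = velocity (𝓡 4) γ b := by rw [hvel 0 hD0, hζ0, hζv, hv]
    have hsub := lift_sub_of_isMaximal 𝓢 hγ hb hζ.isOpen hζ.2.1 hD0 hgeo hρ0 hρv
    refine ⟨ζ, D, hζ, hD0, hsub, fun u hu ↦ ?_⟩
    rw [← hvel u hu]
    -- `ΨW ∘ ζ = γ (· + b)` near `u`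
    have hev : (ΨW ∘ ζ) =ᶠ[𝓝 u] fun u ↦ γ (u - (-b)) := by
      filter_upwards [hζ.isOpen.mem_nhds hu] with u' hu'
      rw [(hsub u' hu').2, sub_neg_eq_add]
    rw [velocity_congr_of_eventuallyEq hev, velocity_comp_sub_const, sub_neg_eq_add]
  /- 4. the lift at `t₀` reaches over the whole tail -/
  obtain ⟨x₀, hx₀S, hx₀⟩ := htail t₀ ht₀ le_rfl
  obtain ⟨ζ, D, hζ, hD0, hζsub, hζvel⟩ := key t₀ ht₀ ⟨x₀.1, mem_image_of_mem _ hx₀S⟩ (by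
    show Ψ (ι ⟨x₀.1, _⟩) = γ t₀
    rw [← hx₀]; congr 1)
  have hreach : ∀ t ∈ dom, t₀ ≤ t → t - t₀ ∈ D := by
    intro t ht htt
    refine IsMaximalGeodesicOn.mem_of_forall_exists_lift (cov := gW.leviCivita) (χ := ΨW) hΨWinj
      (c := fun s ↦ γ (s + t₀)) (dom := {s | s + t₀ ∈ dom}) ?_ hζ hD0 (fun u hu ↦ (hζsub u hu).1)
      (fun u hu ↦ (hζsub u hu).2) ?_ (by simpa using ht) (by linarith) ?_
    · exact ⟨fun a ha c hc u hu ↦ hdom.out ha hc ⟨by linarith [hu.1], by linarith [hu.2]⟩⟩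
    · -- local lifts at every `b` with `γ (b + t₀) ∈ range ΨW`
      rintro b hb ⟨y, hy⟩
      obtain ⟨ζb, Db, hζb, hDb0, hζbsub, -⟩ := key (b + t₀) hb y hy
      refine ⟨ζb, Db, hζb.isOpen, hζb.2.1, hDb0, hζb.isGeodesicOn, fun u hu ↦ ?_⟩
      rw [(hζbsub u hu).2, add_assoc]
    · intro s hs
      have hsdom : s + t₀ ∈ dom := hdom.out ht₀ ht ⟨by linarith [hs.1], by linarith [hs.2]⟩
      rw [← hrange]
      exact htail _ hsdom (by linarith [hs.1])
  /- 5. the coordinate curve and the readout -/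
  refine ⟨fun t ↦ ((ζ (t - t₀) : W) : E4), fun t ↦ velocity 𝓘(ℝ, E4) ζ (t - t₀), ?_⟩
  intro t ht htt
  have hu : t - t₀ ∈ D := hreach t ht htt
  obtain ⟨hpos, hvel⟩ := OpensChart.hasDerivAt_of_isGeodesicOn hGW hGd hζ.isGeodesicOn hu
  obtain ⟨hC, -⟩ := OpensChart.contDiffAt_of_isGeodesicOn hGW hGd (Φ := fun z v ↦ chrAt G z v v) hΓsm hΓeq
    hζ.isOpen hζ.isGeodesicOn hu
  refine ⟨⟨ι (ζ (t - t₀)), hιS _, ?_, rfl, ?_⟩, ?_, ?_, ?_⟩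
  · have h := (hζsub _ hu).2
    rwa [sub_add_cancel] at h
  · have h := hζvel _ hu
    rw [sub_add_cancel, hdΨW] at h
    exact h
  · have h2 : ContDiffAt ℝ 2 (fun t' ↦ ((ζ t' : W) : E4)) (t - t₀) := hC.of_le (WithTop.coe_le_coe.2 le_top)
    have hs : ContDiffAt ℝ 2 (fun s : ℝ ↦ s - t₀) t := contDiffAt_id.sub contDiffAt_const
    have hcomp : ContDiffAt ℝ 2 ((fun t' ↦ ((ζ t' : W) : E4)) ∘ fun s : ℝ ↦ s - t₀) t := h2.comp t hs
    exact hcomp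
  · exact hpos.comp_sub_const t t₀
  · have h := hvel.comp_sub_const t t₀
    rwa [← hΓeq] at h

end Summit.FinalStateConjecture.FinalStateConjecture.Theorems.BartnikGapSettling.SettledCapture

end
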